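import Literature.Geometry.Kaehler.ComplexTorusLefschetzLieAlgebraRatCenterIsogenyFactors
import Literature.Geometry.Kaehler.ComplexTorusHodgeLieAlgebraRatForm
import HarnessLib

/-!
# The centre of the Hodge Lie algebra is bounded by the centre of `Lie S(X)`: `dim_ℚ 𝔷(Lie Hg(X)) ≤ dim_ℚ 𝔷(Lie S(X))`, hence
# `≤ e₀ = [K₀ : ℚ]` for a simple polarised torus with CM centre, `= 0` for a totally real centre, and
# `dim 𝔷(Lie Hg(X)) + Σₖ [K_k⁺ : ℚ] ≤ Σₖ [K_k : ℚ]` over the simple factors of `X ∼ ∏ₖ B_k^{n_k}`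

Layer `Literature/Geometry/Kaehler`, namespace `Literature.Geometry.Kaehler.ComplexTorus`; lane `lit-hodgefound` (Track 2
foundations library); prover seat `lit-hodgefound-p17`, generation 60, self-proposed row g60-#7 — the HODGE-SIDE reading of ✔ g60-#5 ∕ #6:
p36's set inclusion `𝔷(𝒜) ⊆ 𝔷(Lie S(X))` (`IsRiemannForm.coe_center_hodgeGroupLieRat_subset_coe_center_lefschetzLieRat`: a central
element of `𝒜 = Lie Hg(X)` is an endomorphism, hence commutes with `Lie S(X) ⊆ C(X)`) made into a dimension bound, and fed with the
centre counts of ✔ g60-#5 (simple: `dim 𝔷(Lie S) = e − e₀`) and ✔ g60-#6 (factors).  «The connected centre of `Hg(X)` lies in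
`∏ U_{K_k}` over the type IV factors»: `dim Z(Hg)° ≤ Σ_{IV} e₀(B_k)`.  THEOREMS ONLY (no definition, no instance, no notation, no named
fact; D-0026 net debt `0`).

## Sources, VERBATIM

* B. Moonen, Yu. G. Zarhin [MoonenZarhin1999LowDim], Math. Ann. **315** (1999) (held `paper:arxiv-math_9901113`), §1 (p0002): «`Hg(X) ⊂
  Sp_D(V, φ)`, the centralizer of `D` in the symplectic group … The Hodge group `Hg(X)` is a torus if and only if `X` is of CM-type.  If
  `X` has no factors of Type 4 then `Hg(X)` is semi-simple.»
* J. S. Milne [Milne1999LefschetzClasses], Duke Math. J. **96** (1999), §1 p. 645 («`S₀(A)(R) = {γ ∈ C₀(A) ⊗_ℚ R ∣ γ†γ = 1}`»), §4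
  («`Hg(A) ⊂ L(A)`»; Prop. 4.8) and §2 Summary table p. 652.
* H. Lange [Lange2023AbelianVarietiesComplex], §7.2.2 Prop. 7.2.5 («`End_ℚ(X) = End_{Hg(X)}(H_1(X, ℚ))`»), §7.2.4 Exercise (2) («`Hg(X)` …
  is semisimple if and only if the centre of the Mumford–Tate group … consists only of scalars») and Exercise (4)(b) («`Hg(X) ⊆ Lf(X)`»).

## What is proved (`𝒜 = hodgeGroupLieRat Φ = Lie Hg(X)` over `ℚ`, `Lie S(X) = lefschetzLieRat Φ G`, `𝔷 = LieAlgebra.center ℚ`)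

* §1 every polarised torus: **`IsRiemannForm.finrank_center_hodgeGroupLieRat_le_finrank_center_lefschetzLieRat`** (`dim 𝔷(𝒜) ≤ dim 𝔷(Lie S(X))`).
* §2 simple polarised tori: **`IsSimple.finrank_center_hodgeGroupLieRat_le_of_isCMField`** (`dim 𝔷(𝒜) ≤ [K₀ : ℚ] = e₀`),
  `IsSimple.finrank_center_hodgeGroupLieRat_eq_zero_of_isTotallyReal`, **`IsSimple.finrank_center_hodgeGroupLieRat_add_finrank_maximalRealSubfield_le`**
  (`dim 𝔷(𝒜) + [K₀:ℚ] ≤ [K:ℚ]`, every simple polarised torus).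
* §3 factors: **`IsIsogenous.finrank_center_hodgeGroupLieRat_add_sum_le_sum`** (`dim 𝔷(𝒜(X)) + Σₖ [K_k⁺:ℚ] ≤ Σₖ [K_k:ℚ]` for `X ∼ ∏ B_k^{n_k}`).

NOT here: the exact centre of `Hg` (it depends on the Hodge structure, not only on `End_ℚ(X)`: `0` for Weil type with `Hg = SU`, all of `U¹_K`
for CM type); the Mumford–Tate form `𝔷(𝔪𝔱) = ℚ ⊕ 𝔷(𝒜)`.
-/

noncomputable section

open scoped Matrix
open Module Matrix Complex Function NumberField

namespace Literature.Geometry.Kaehler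

namespace ComplexTorus

/-! ## §1 `dim 𝔷(Lie Hg(X)) ≤ dim 𝔷(Lie S(X))` -/

section General

variable {ι : Type*} [Fintype ι] [DecidableEq ι] {E : Type*} [NormedAddCommGroup E] [NormedSpace ℂ E]
  {Φ : (ι → ℝ) ≃L[ℝ] E} {η : E [⋀^Fin 2]→L[ℝ] ℝ} {G : Matrix ι ι ℚ}

/-- **`dim_ℚ 𝔷(Lie Hg(X)) ≤ dim_ℚ 𝔷(Lie S(X))` FOR A POLARISED COMPLEX TORUS**: a central element of `𝒜 = Lie Hg(X)` commutes with `Hg(X)`, so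
it is (the rational representation of) an endomorphism (`End_ℚ(X) = End_{Hg(X)}`), hence commutes with all of `Lie S(X) ⊆ C(X)` — the
inclusion `𝔷(𝒜) ↪ 𝔷(Lie S(X))` is `ℚ`-linear and injective. [cite: Lange2023AbelianVarietiesComplex, §7.2.2 Prop. 7.2.5 and §7.2.4 Exercise (4)(b)]
[cite: Milne1999LefschetzClasses, §4 («`Hg(A) ⊂ L(A)`») and §1 p. 645 («`S₀`»)] -/
theorem IsRiemannForm.finrank_center_hodgeGroupLieRat_le_finrank_center_lefschetzLieRat (hη : IsRiemannForm Φ η)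
    (hG : G.map (Rat.cast : ℚ → ℝ) = latticeGram Φ η) :
    finrank ℚ ↥(LieAlgebra.center ℚ ↥(hodgeGroupLieRat Φ)) ≤ finrank ℚ ↥(LieAlgebra.center ℚ ↥(lefschetzLieRat Φ G)) := by
  haveI : Module.Finite ℚ ↥(lefschetzLieRat Φ G) := finite_lefschetzLieRat Φ G
  have hsub := hη.coe_center_hodgeGroupLieRat_subset_coe_center_lefschetzLieRat hG
  -- the central element `x` of `𝒜`, as an element of `Lie S(X)`, is central there
  have hmem : ∀ x : ↥(LieAlgebra.center ℚ ↥(hodgeGroupLieRat Φ)),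
      (⟨((x : hodgeGroupLieRat Φ) : Matrix ι ι ℚ), hη.hodgeGroupLieRat_le_lefschetzLieRat hG (x : hodgeGroupLieRat Φ).2⟩ :
        lefschetzLieRat Φ G) ∈ LieAlgebra.center ℚ ↥(lefschetzLieRat Φ G) := fun x ↦ by
    obtain ⟨y, hy, hyx⟩ := hsub ⟨(x : hodgeGroupLieRat Φ), x.2, rfl⟩
    have hyeq : y = ⟨((x : hodgeGroupLieRat Φ) : Matrix ι ι ℚ), hη.hodgeGroupLieRat_le_lefschetzLieRat hG (x : hodgeGroupLieRat Φ).2⟩ :=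
      Subtype.ext hyx
    rw [← hyeq]
    exact hy
  let f : ↥(LieAlgebra.center ℚ ↥(hodgeGroupLieRat Φ)) →+ ↥(LieAlgebra.center ℚ ↥(lefschetzLieRat Φ G)) :=
    { toFun := fun x ↦ ⟨_, hmem x⟩
      map_zero' := Subtype.ext (Subtype.ext rfl)
      map_add' := fun _ _ ↦ Subtype.ext (Subtype.ext rfl) }
  refine LinearMap.finrank_le_finrank_of_injective (f := f.toRatLinearMap) fun x y hxy ↦ ?_
  have h := congrArg (fun z : ↥(LieAlgebra.center ℚ ↥(lefschetzLieRat Φ G)) ↦ ((z : lefschetzLieRat Φ G) : Matrix ι ι ℚ)) hxy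
  exact Subtype.ext (Subtype.ext h)

end General

/-! ## §2 Simple polarised tori: `dim 𝔷(Lie Hg(X)) ≤ e₀` -/

section Simple

variable {κ : Type} [Fintype κ] [DecidableEq κ] [Nonempty κ] {E : Type} [NormedAddCommGroup E] [NormedSpace ℂ E]
  {Ψ : (κ → ℝ) ≃L[ℝ] E} {η : E [⋀^Fin 2]→L[ℝ] ℝ} {G : Matrix κ κ ℚ}

/-- **`dim_ℚ 𝔷(Lie Hg(X)) ≤ [K₀ : ℚ] = e₀` FOR A SIMPLE POLARISED TORUS WITH CM CENTRE `K`** (`𝔷(𝒜) ⊆ 𝔷(Lie S(X)) = θ·K₀`: the connected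
centre of `Hg(X)` lies in the torus `U¹_{K/K₀}` of dimension `e₀`). [cite: MoonenZarhin1999LowDim, §1 («`Hg(X) ⊂ Sp_D(V,φ)`»)]
[cite: Milne1999LefschetzClasses, §1 p. 645 («`S₀`») and §4] [cite: Lange2023AbelianVarietiesComplex, §2.6.1 (`e₀`) and §7.2.4 Exercise (2)] -/
theorem IsSimple.finrank_center_hodgeGroupLieRat_le_of_isCMField (hX : IsSimple Ψ) (hη : IsRiemannForm Ψ η)
    (hG : G.map (Rat.cast : ℚ → ℝ) = latticeGram Ψ η) [IsCMField (centerField Ψ hX)] :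
    finrank ℚ ↥(LieAlgebra.center ℚ ↥(hodgeGroupLieRat Ψ)) ≤ finrank ℚ ↥(maximalRealSubfield (centerField Ψ hX)) := by
  rw [← hX.finrank_center_lefschetzLieRat_eq_of_isCMField hη hG]
  exact hη.finrank_center_hodgeGroupLieRat_le_finrank_center_lefschetzLieRat hG

/-- Totally real centre (types I–III): `dim_ℚ 𝔷(Lie Hg(X)) = 0` (`Hg(X)` is semisimple — Moonen–Zarhin). [cite: MoonenZarhin1999LowDim, §1 («If `X` has no factors of Type 4 then `Hg(X)` is semi-simple»)]
[cite: Milne1999LefschetzClasses, §2 p. 646] -/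
theorem IsSimple.finrank_center_hodgeGroupLieRat_eq_zero_of_isTotallyReal (hX : IsSimple Ψ) [IsTotallyReal (centerField Ψ hX)]
    (hη : IsRiemannForm Ψ η) (hG : G.map (Rat.cast : ℚ → ℝ) = latticeGram Ψ η) :
    finrank ℚ ↥(LieAlgebra.center ℚ ↥(hodgeGroupLieRat Ψ)) = 0 :=
  Nat.eq_zero_of_le_zero ((hη.finrank_center_hodgeGroupLieRat_le_finrank_center_lefschetzLieRat hG).trans
    (hX.finrank_center_lefschetzLieRat_eq_zero_of_isTotallyReal hη hG).le)

/-- **`dim_ℚ 𝔷(Lie Hg(X)) + [K₀ : ℚ] ≤ [K : ℚ]` FOR EVERY SIMPLE POLARISED COMPLEX TORUS** (`= e − e₀ ≥ dim 𝔷(𝒜)`: `0` in lines I–III,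
`e₀` in line IV). [cite: Lange2023AbelianVarietiesComplex, §2.6.1 Proposition (column `e₀`) and §7.2.4 Exercise (2)] [cite: Milne1999LefschetzClasses, §1 p. 645 and §4] -/
theorem IsSimple.finrank_center_hodgeGroupLieRat_add_finrank_maximalRealSubfield_le (hX : IsSimple Ψ) (hη : IsRiemannForm Ψ η)
    (hG : G.map (Rat.cast : ℚ → ℝ) = latticeGram Ψ η) :
    finrank ℚ ↥(LieAlgebra.center ℚ ↥(hodgeGroupLieRat Ψ)) + finrank ℚ ↥(maximalRealSubfield (centerField Ψ hX)) ≤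
      finrank ℚ (centerField Ψ hX) := by
  rw [← hX.finrank_center_lefschetzLieRat_add_finrank_maximalRealSubfield_eq hη hG]
  exact Nat.add_le_add_right (hη.finrank_center_hodgeGroupLieRat_le_finrank_center_lefschetzLieRat hG) _

end Simple

/-! ## §3 Over the simple factors -/

section Factors

variable {ι : Type} [Fintype ι] [DecidableEq ι] {E : Type} [NormedAddCommGroup E] [NormedSpace ℂ E]
  {Φ : (ι → ℝ) ≃L[ℝ] E} {η : E [⋀^Fin 2]→L[ℝ] ℝ} {G₀ : Matrix ι ι ℚ}
  {κ : Type} [Fintype κ] [DecidableEq κ] {σ : κ → Type} [∀ k, Fintype (σ k)] [∀ k, DecidableEq (σ k)] [∀ k, Nonempty (σ k)]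
  {F : κ → Type} [∀ k, NormedAddCommGroup (F k)] [∀ k, NormedSpace ℂ (F k)]
  {Ψ : ∀ k, (σ k → ℝ) ≃L[ℝ] F k} {ω : ∀ k, F k [⋀^Fin 2]→L[ℝ] ℝ} {G : ∀ k, Matrix (σ k) (σ k) ℚ} {n : κ → ℕ}

/-- **`dim_ℚ 𝔷(Lie Hg(X)) + Σₖ [K_k⁺ : ℚ] ≤ Σₖ [K_k : ℚ]` over the simple factors of `X ∼ ∏ₖ B_k^{n_k}`** — the connected centre of `Hg(X)`
has dimension at most the sum of `e₀(B_k)` over the factors of type IV; in particular `0` when there is no such factor (Moonen–Zarhin).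
[cite: MoonenZarhin1999LowDim, §1 («If `X` has no factors of Type 4 then `Hg(X)` is semi-simple»)] [cite: Milne1999LefschetzClasses, §1 Prop. 1.5, p. 645 («`S₀`») and §4]
[cite: Lange2023AbelianVarietiesComplex, §7.2.4 Exercise (2) and (4)] -/
theorem IsIsogenous.finrank_center_hodgeGroupLieRat_add_sum_le_sum (hη : IsRiemannForm Φ η)
    (hG₀ : G₀.map (Rat.cast : ℚ → ℝ) = latticeGram Φ η) (h : ∀ k, IsRiemannForm (Ψ k) (ω k))
    (hG : ∀ k, (G k).map (Rat.cast : ℚ → ℝ) = latticeGram (Ψ k) (ω k)) (hs : ∀ k, IsSimple (Ψ k))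
    (hni : ∀ k l, k ≠ l → ¬ IsIsogenous (Ψ k) (Ψ l)) (hn : ∀ k, 0 < n k)
    (hX : IsIsogenous Φ (sigmaPiPeriod fun k ↦ powPeriod (Ψ k) (n k))) :
    finrank ℚ ↥(LieAlgebra.center ℚ ↥(hodgeGroupLieRat Φ)) + ∑ k, finrank ℚ ↥(maximalRealSubfield (centerField (Ψ k) (hs k))) ≤
      ∑ k, finrank ℚ (centerField (Ψ k) (hs k)) := by
  rw [← hX.finrank_center_lefschetzLieRat_add_sum_eq_sum hη hG₀ h hG hs hni hn]
  exact Nat.add_le_add_right (hη.finrank_center_hodgeGroupLieRat_le_finrank_center_lefschetzLieRat hG₀) _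

end Factors

end ComplexTorus

end Literature.Geometry.Kaehler

end
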